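import Mathlib.Analysis.InnerProductSpace.GramSchmidtOrtho
import Mathlib.Data.ZMod.Basic
import Literature.Algebra.EuclideanLattices.IntegerBases
import Literature.Algebra.EuclideanLattices.SmoothingParameterGramSchmidt
import HarnessLib

/-!
# The lattices `q⁻¹ℤⁿ ⊆ ℝⁿ`: membership, `ℤⁿ ≤ q⁻¹ℤⁿ`, representatives of `q⁻¹ℤⁿ/ℤⁿ ≅ ℤ_qⁿ`, smoothing parameter

Topic `Algebra/EuclideanLattices` (family `pqc`). Coordinate layer for BLPRS 2013 §3 (modulus switching)
in the decomposition of the named fact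
`Literature.Computability.Cryptography.blprs_gapSVP_sqrt_dim_to_lwe_classical` (**pqc.S21**): the
torus `𝕋_qⁿ` of BLPRS §2.3 is `q⁻¹ℤⁿ/ℤⁿ`, the lattice `Λ` of Thm. 3.1 / Lemma 3.5 for `G = I` (Cor. 3.2)
is `q'⁻¹ℤⁿ ⊇ ℤⁿ` with basis `I/q'`, and the reduction reads its input `a ∈ 𝕋_qⁿ` through the
representative `ā ∈ q⁻¹ℤⁿ` and outputs the class of a point of `q'⁻¹ℤⁿ` modulo `ℤⁿ`. This file provides
these objects in the tree's Euclidean-lattice vocabulary (`stdIntLattice n = ℤⁿ ⊆ EuclideanSpace ℝ (Fin n)`,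
`IntegerBases.lean`), in the shape consumed by the coordinate-free Lemma 3.5
(`ModulusSwitchCore.lean`, `BLPRS2013.IsCosetReps`). Everything is PROVED; no named fact.

## Results

* `invScaledBasis n q` (`(q⁻¹e_j)_j`), `invScaledIntLattice n q = q⁻¹ℤⁿ` (a `ZSpan`, so discrete and
  `IsZLattice`), `mem_invScaledIntLattice_iff` (`x ∈ q⁻¹ℤⁿ ↔ ∀ j, q x_j ∈ ℤ`),
  `stdIntLattice_le_invScaledIntLattice` (`ℤⁿ ≤ q⁻¹ℤⁿ`).
* `torusRep n q a = ā = (a_j/q)_j` (`a ∈ ℤ_qⁿ`, canonical lifts), `torusRep_mem`; `num`, `torusClass`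
  (`y ↦ (q y_j mod q)_j`); **`torusClass_eq_iff`**: `torusClass y = a ↔ y - ā ∈ ℤⁿ` (a system of
  representatives of `q⁻¹ℤⁿ/ℤⁿ`), `torusClass_torusRep`.
* `gramSchmidt_invScaledBasis`, `norm_invScaledBasis`, and **BLPRS Lemma 2.5 for `q⁻¹ℤⁿ`**:
  `smoothingParameter_invScaledIntLattice_le` (`η_ε(q⁻¹ℤⁿ) ≤ q⁻¹√(ln(2n(1+1/ε))/π)`, from the tree's
  GPV08 Lemma 3.1 `smoothingParameter_le_norm_gramSchmidt_mul`) and the form used by Lemma 3.5,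
  `smoothingParameter_invScaledIntLattice_le_div_sqrt_two`
  (`r ≥ q⁻¹√(2 ln(2n(1+1/ε))/π) → η_ε(q⁻¹ℤⁿ) ≤ r/√2`).

## References

* Z. Brakerski, A. Langlois, C. Peikert, O. Regev, D. Stehlé, *Classical hardness of learning with
  errors*, STOC 2013 = arXiv:1306.0281, §2.3 (`𝕋_q`), Lemma 2.5, Cor. 3.2 and Lemma 3.5
  [BrakerskiEtAl2013].
* C. Gentry, C. Peikert, V. Vaikuntanathan, *Trapdoors for hard lattices and new cryptographic
  constructions*, STOC 2008, Lemma 3.1 [GentryPeikertVaikuntanathan2008].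
-/

noncomputable section

open Module Submodule InnerProductSpace
open scoped Real

namespace Literature.Algebra.EuclideanLattices

variable (n q : ℕ) [NeZero q]

/-- The orthogonal basis `(q⁻¹ e_j)_j` of `ℝⁿ`. [cite: BrakerskiEtAl2013, Cor. 3.2 ("`B = I/q'`")] -/
def invScaledBasis : Basis (Fin n) ℝ (EuclideanSpace ℝ (Fin n)) :=
  (EuclideanSpace.basisFun (Fin n) ℝ).toBasis.unitsSMul fun _ =>
    (Units.mk0 (q : ℝ) (by exact_mod_cast NeZero.ne q))⁻¹

/-- `invScaledBasis n q j = q⁻¹ • e_j`. [folklore] -/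
theorem invScaledBasis_apply (j : Fin n) :
    invScaledBasis n q j = (q : ℝ)⁻¹ • EuclideanSpace.basisFun (Fin n) ℝ j := by
  simp [invScaledBasis, Module.Basis.unitsSMul_apply, Units.smul_def]

/-- Coordinates in the basis `(q⁻¹ e_j)`: `repr x j = q · x_j`. [folklore] -/
theorem invScaledBasis_repr (x : EuclideanSpace ℝ (Fin n)) (j : Fin n) :
    (invScaledBasis n q).repr x j = q * x j := by
  simp [invScaledBasis, Module.Basis.repr_unitsSMul, Units.smul_def]

/-- The lattice `q⁻¹ℤⁿ = span_ℤ {q⁻¹e₁, …, q⁻¹eₙ} ⊆ ℝⁿ` (so that `q⁻¹ℤⁿ/ℤⁿ = 𝕋_qⁿ`, BLPRS §2.3; the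
lattice `Λ` of Thm. 3.1 for `G = I` is `q'⁻¹ℤⁿ`, Cor. 3.2). [cite: BrakerskiEtAl2013, §2.3 and Cor. 3.2] -/
def invScaledIntLattice : Submodule ℤ (EuclideanSpace ℝ (Fin n)) :=
  span ℤ (Set.range (invScaledBasis n q))

/-- `q⁻¹ℤⁿ` is discrete. [folklore] -/
instance : DiscreteTopology (invScaledIntLattice n q) :=
  inferInstanceAs (DiscreteTopology (span ℤ (Set.range (invScaledBasis n q))))

/-- `q⁻¹ℤⁿ` is a full-rank lattice. [folklore] -/
instance : IsZLattice ℝ (invScaledIntLattice n q) :=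
  inferInstanceAs (IsZLattice ℝ (span ℤ (Set.range (invScaledBasis n q))))

/-- Membership: `x ∈ q⁻¹ℤⁿ ↔ q x_j ∈ ℤ` for all `j`. [folklore] -/
theorem mem_invScaledIntLattice_iff (x : EuclideanSpace ℝ (Fin n)) :
    x ∈ invScaledIntLattice n q ↔ ∀ j, ∃ k : ℤ, (k : ℝ) = q * x j := by
  rw [invScaledIntLattice, Module.Basis.mem_span_iff_repr_mem]
  simp only [invScaledBasis_repr]
  rfl

/-- `ℤⁿ ≤ q⁻¹ℤⁿ`. [folklore] -/
theorem stdIntLattice_le_invScaledIntLattice : stdIntLattice n ≤ invScaledIntLattice n q := by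
  intro x hx
  rw [mem_invScaledIntLattice_iff]
  intro j
  obtain ⟨k, hk⟩ := (mem_stdIntLattice_iff x).1 hx j
  exact ⟨q * k, by push_cast; rw [hk]⟩

/-! ### Representatives of `q⁻¹ℤⁿ / ℤⁿ ≅ ℤ_qⁿ` -/

/-- The distinguished representative `ā = (a_j/q)_j ∈ q⁻¹ℤⁿ ∩ [0,1)ⁿ` of `a ∈ ℤ_qⁿ = 𝕋_qⁿ`
(`a_j ∈ {0, …, q-1}` the canonical lift). [cite: BrakerskiEtAl2013, §2.3] -/
def torusRep (a : Fin n → ZMod q) : EuclideanSpace ℝ (Fin n) :=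
  WithLp.toLp 2 fun j => ((a j).val : ℝ) / q

omit [NeZero q] in
/-- `(torusRep a)_j = a_j / q`. [folklore] -/
@[simp]
theorem torusRep_apply (a : Fin n → ZMod q) (j : Fin n) : torusRep n q a j = ((a j).val : ℝ) / q := rfl

/-- `ā ∈ q⁻¹ℤⁿ`. [folklore] -/
theorem torusRep_mem (a : Fin n → ZMod q) : torusRep n q a ∈ invScaledIntLattice n q := by
  rw [mem_invScaledIntLattice_iff]
  intro j
  refine ⟨(a j).val, ?_⟩
  have hq : (q : ℝ) ≠ 0 := by exact_mod_cast NeZero.ne q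
  rw [torusRep_apply]
  field_simp
  push_cast
  ring

/-- The integer numerators of a point of `q⁻¹ℤⁿ`: `y_j = (num y j)/q`. [folklore] -/
def num (y : invScaledIntLattice n q) (j : Fin n) : ℤ :=
  ((mem_invScaledIntLattice_iff n q (y : EuclideanSpace ℝ (Fin n))).1 y.2 j).choose

/-- `(num y j : ℝ) = q · y_j`. [folklore] -/
theorem num_spec (y : invScaledIntLattice n q) (j : Fin n) :
    (num n q y j : ℝ) = q * (y : EuclideanSpace ℝ (Fin n)) j :=
  ((mem_invScaledIntLattice_iff n q (y : EuclideanSpace ℝ (Fin n))).1 y.2 j).choose_spec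

/-- The class map `q⁻¹ℤⁿ → ℤ_qⁿ`, `y ↦ (q y_j mod q)_j` (the quotient map `q⁻¹ℤⁿ → q⁻¹ℤⁿ/ℤⁿ = 𝕋_qⁿ`).
[cite: BrakerskiEtAl2013, §2.3] -/
def torusClass (y : invScaledIntLattice n q) : Fin n → ZMod q :=
  fun j => ((num n q y j : ℤ) : ZMod q)

/-- **`torusRep`/`torusClass` form a system of representatives of `q⁻¹ℤⁿ` modulo `ℤⁿ`**:
`torusClass y = a ↔ y - ā ∈ ℤⁿ`. [folklore] -/
theorem torusClass_eq_iff (y : invScaledIntLattice n q) (a : Fin n → ZMod q) :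
    torusClass n q y = a ↔ (y : EuclideanSpace ℝ (Fin n)) - torusRep n q a ∈ stdIntLattice n := by
  have hq : (q : ℝ) ≠ 0 := by exact_mod_cast NeZero.ne q
  rw [mem_stdIntLattice_iff, funext_iff]
  refine forall_congr' fun j => ?_
  rw [torusClass]
  -- `(num y j : ZMod q) = a j ↔ q ∣ num y j - (a j).val ↔ (num y j - (a j).val)/q ∈ ℤ`
  have hval : (a j : ZMod q) = (((a j).val : ℤ) : ZMod q) := by simp
  constructor
  · intro h
    rw [hval, ZMod.intCast_eq_intCast_iff_dvd_sub] at h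
    obtain ⟨c, hc⟩ := h
    refine ⟨-c, ?_⟩
    have hy : (y : EuclideanSpace ℝ (Fin n)) j = (num n q y j : ℝ) / q := by
      rw [num_spec]; field_simp
    simp only [PiLp.sub_apply, torusRep_apply, hy]
    have hc' : ((num n q y j : ℤ) : ℝ) = ((a j).val : ℝ) - q * c := by
      have := congrArg (fun z : ℤ => (z : ℝ)) hc
      push_cast at this ⊢
      linarith
    rw [hc']
    field_simp
    push_cast
    ring
  · rintro ⟨k, hk⟩
    rw [hval, ZMod.intCast_eq_intCast_iff_dvd_sub]
    refine ⟨-k, ?_⟩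
    have h1 : (k : ℝ) * q = q * (y : EuclideanSpace ℝ (Fin n)) j - (a j).val := by
      simp only [PiLp.sub_apply, torusRep_apply] at hk
      rw [hk]
      field_simp
    have h2 : ((((a j).val : ℤ) - num n q y j : ℤ) : ℝ) = ((q * -k : ℤ) : ℝ) := by
      push_cast
      rw [num_spec]
      linarith
    exact_mod_cast h2

/-- The class of `ā` is `a`. [folklore] -/
theorem torusClass_torusRep (a : Fin n → ZMod q) :
    torusClass n q ⟨torusRep n q a, torusRep_mem n q a⟩ = a := by
  rw [torusClass_eq_iff]
  simp

/-! ### The smoothing parameter of `q⁻¹ℤⁿ` (BLPRS Lemma 2.5 with `‖B̃‖ = 1/q`) -/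

/-- The basis `(q⁻¹e_j)` is orthogonal, so it is its own Gram–Schmidt orthogonalisation. [folklore] -/
theorem gramSchmidt_invScaledBasis :
    gramSchmidt ℝ (invScaledBasis n q : Fin n → EuclideanSpace ℝ (Fin n)) = invScaledBasis n q := by
  refine gramSchmidt_of_orthogonal ℝ fun i j hij => ?_
  simp only [invScaledBasis_apply, inner_smul_left, inner_smul_right]
  rw [show ⟪(EuclideanSpace.basisFun (Fin n) ℝ) i, (EuclideanSpace.basisFun (Fin n) ℝ) j⟫_ℝ = 0 from
    (EuclideanSpace.basisFun (Fin n) ℝ).orthonormal.2 hij]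
  simp

/-- `‖q⁻¹ e_j‖ = q⁻¹`. [folklore] -/
theorem norm_invScaledBasis (j : Fin n) : ‖invScaledBasis n q j‖ = (q : ℝ)⁻¹ := by
  rw [invScaledBasis_apply, norm_smul, (EuclideanSpace.basisFun (Fin n) ℝ).orthonormal.1 j, mul_one,
    Real.norm_of_nonneg (by positivity)]

/-- **BLPRS Lemma 2.5 for `q⁻¹ℤⁿ`** (basis `I/q`, `‖B̃‖ = 1/q`): for `ε > 0`,
`η_ε(q⁻¹ℤⁿ) ≤ q⁻¹ · √(ln(2n(1+1/ε))/π)` (the tree's `smoothingParameter_le_norm_gramSchmidt_mul`,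
GPV08 Lemma 3.1). This is how the hypothesis `r ≥ max(q⁻¹, ‖B̃‖) · √(2 ln(2n(1+1/ε))/π)` of Lemma 3.5
yields `r ≥ √2 η_ε(q⁻¹ℤⁿ)` and `r ≥ √2 η_ε(q'⁻¹ℤⁿ)`. [cite: BrakerskiEtAl2013, Lemma 2.5 and Lemma 3.5 (proof: "using that `r ≥ η_ε(Λ)` by Lemma 2.5")] -/
theorem smoothingParameter_invScaledIntLattice_le {ε : ℝ} (hε : 0 < ε) :
    smoothingParameter (invScaledIntLattice n q) ε ≤
      (q : ℝ)⁻¹ * Real.sqrt (Real.log (2 * n * (1 + 1 / ε)) / π) := by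
  have h := smoothingParameter_le_norm_gramSchmidt_mul (invScaledIntLattice n q)
    ((invScaledBasis n q).restrictScalars ℤ) hε (M := (q : ℝ)⁻¹) (fun i => ?_)
  · exact h
  · -- the `ℤ`-basis vectors are the `q⁻¹ e_j` (stated through a generic `F` to sidestep the two
    -- (propositionally equal) `ℤ`-module structures on the span)
    have key : ∀ F : Fin n → EuclideanSpace ℝ (Fin n),
        F = (invScaledBasis n q : Fin n → EuclideanSpace ℝ (Fin n)) →
          ‖gramSchmidt ℝ F i‖ ≤ (q : ℝ)⁻¹ := by
      rintro F rfl
      rw [gramSchmidt_invScaledBasis, norm_invScaledBasis]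
    refine key _ (funext fun j => ?_)
    exact Module.Basis.restrictScalars_apply ℤ (invScaledBasis n q) j

/-- The form used by Lemma 3.5: if `r ≥ q⁻¹ √(2 ln(2n(1+1/ε))/π)` then `η_ε(q⁻¹ℤⁿ) ≤ r/√2`. [cite: BrakerskiEtAl2013, Lemma 3.5 (hypothesis on `r`)] -/
theorem smoothingParameter_invScaledIntLattice_le_div_sqrt_two {ε r : ℝ} (hε : 0 < ε)
    (hr : (q : ℝ)⁻¹ * Real.sqrt (2 * Real.log (2 * n * (1 + 1 / ε)) / π) ≤ r) :
    smoothingParameter (invScaledIntLattice n q) ε ≤ r / Real.sqrt 2 := by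
  refine (smoothingParameter_invScaledIntLattice_le n q hε).trans ?_
  rw [le_div_iff₀ (Real.sqrt_pos.2 (by norm_num : (0 : ℝ) < 2))]
  calc (q : ℝ)⁻¹ * Real.sqrt (Real.log (2 * n * (1 + 1 / ε)) / π) * Real.sqrt 2
      = (q : ℝ)⁻¹ * Real.sqrt (2 * Real.log (2 * n * (1 + 1 / ε)) / π) := by
        rw [mul_assoc, ← Real.sqrt_mul' _ (by norm_num : (0 : ℝ) ≤ 2)]
        congr 2
        ring
    _ ≤ r := hr

end Literature.Algebra.EuclideanLattices

end
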